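import Literature.NumberTheory.EllipticCurves.HeegnerModuleIndex
import HarnessLib

/-!
# The `Λ`-adic Heegner class of `p`-power conductor at a prime `p ∣ N` (Bertolini–Darmon 1996, §2.5,
# eq. (7)–(8); Castella 2024, §2.2, eq. (2.2)–(2.3)) — a DEFINITION in the tree's Heegner-family
# vocabulary, and the "derived" class relation `𝐳_∞ = (γ - 1) 𝐳_∞'`

Cross-ladder LITERATURE-TYPING layer (D-0088(4)), cell `bsd-littype`, seat `bsd-littype-05` (re-seat
g2). PURPOSE: the one missing NOTION behind two typed GAPS recorded by the cell on 2026-08-26 —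
Keller–Yin arXiv:2402.12781v2 **Thm. 5.2.1** (`multHg`, the Heegner point main conjecture at an
Eisenstein prime `p ‖ N`; seat 05, `FAITHFULNESS-05.md` §3) and Castella arXiv:2409.01360 **Thm. 1.3 /
Prop. 3.2** (the same main conjecture at `p ‖ N` with `E[p]` irreducible; seat 11, module docstring
of `Castella2024/MultiplicativePConverse.lean`: "the regularized Heegner classes `z_m` of `p`-power
conductor at a prime `p ∣ N`, eq. (2.2); the derived class `κ_∞'` … have no tree vocabulary today").
This file DEFINES that vocabulary and asserts NOTHING (no named fact, no claim): one predicate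
`IsLambdaAdicHeegnerClass D F α z` on an element `z` of a `Λ`-adic Selmer datum `D`
(`LambdaAdicSelmerData`, `𝔖_p = lim←_n S_p(E/K_n)`), saying that `z` IS the norm-compatible family
of Kummer images of the regularized Heegner points of `p`-power conductor of a `HeegnerFamily F`,
with regularizing sign `α` (`= a_p(E) = ±1` at a multiplicative prime), plus its elementary API
(uniqueness; the derived-class relation is the equation `z = T • z'`, `T = γ - 1`).

## The sources, verbatim

* **Bertolini–Darmon 1996** (Invent. Math. 126, §2.2–§2.5; held text
  `[corpus: paper:doi-10-1007-s002220050105]`). §2.2 (p0018:L39–L41): "we will also be studying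
  Heegner points of conductor `c pⁿ`, where `(c, NpD) = 1` and `p` is a prime which is not
  necessarily prime to `N`. (In fact, the case `p ∣ N` will be of particular interest to us.)";
  §2.3 (p0020): the Heegner points of conductor `c pⁿ` "are actually defined over the field `K_n`"
  (the ring class field of conductor `c pⁿ`; Shimura reciprocity); §2.4 (p0021), "If `p` divides `N`
  … `Norm_{K_{n+1}/K_n}(P_{n+1}) = U_p P_n` if `n ≥ 1`"; **§2.5, eq. (7)–(8)** (p0023:L1–L12), Case 2
  (`p` divides `N`): "`Norm_{K_{n+1}/K_n}(y_{n+1}) = a_p y_n` if `n ≥ 1`; `u Norm_{K_1/K_0}(y_1) = 0`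
  if `(p) = -1`, `= (a_p - σ) y_0` if `(p) = 1`. Let `α = a_p` be the unit root of `x² - a_p x`.
  Note that `α = ±1` in this case. `z_n = (1/αⁿ) y_n` if `n ≥ 1`; `z_0 = 0` if `(p) = -1`,
  `= u⁻¹ (1 - σ α⁻¹) y_0` if `(p) = 1`", and **Prop. 2.7**: "In all cases, the points `z_n ∈ Z_p`
  are norm-compatible". (Here `y_n = φ(P_n) ∈ E(K_n)`, `σ ∈ Gal(K_0/K)`, `u = ½ #𝒪ˣ`.)
* **Castella 2024** (arXiv:2409.01360, §2.2 "Derived Heegner points", UNREFEREED; held text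
  `[corpus: paper:arxiv-2409.01360 p0005:L19–L60]`), for `E/ℚ` of conductor `N`, `p ‖ N`, `K` with
  `𝒪_K/𝔑 ≃ ℤ/N` (so `p` splits in `K`), `H_{p^m}` the ring class field of conductor `p^m`:
  "Following [BD96], define the regularized Heegner point `z_m ∈ E(H_{p^m}) ⊗ ℤ_p` by
  **(2.2)** `z_m := α^{-m} · y_{p^m}` if `m > 0`, `:= u⁻¹ (1 - α⁻¹ σ) · y_1` if `m = 0` … the points
  `z_m` are norm-compatible. Thus taking their images under the Kummer map
  `E(H_{p^m}) ⊗ ℤ_p → Sel(H_{p^m}, T)` … we obtain the compatible family of cohomology classes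
  `𝐳_∞ := {z_m}_m ∈ lim←_m Sel(H_{p^m}, T)`. With a slight abuse of notation, we continue to denote
  by `𝐳_∞` its natural image in `𝔖_p` [`:= lim←_L lim←_r Sel_{p^r}(E/L)`, `L ⊂ K_∞` finite, §1]" and
  **(2.3)**: "Given a class `𝐳_∞` in the kernel of the specialization map `pr_0 : 𝔖_p → Sel(K, T)`, we
  refer the reader to [cas-split] for the definition of the 'derivative' class `𝐳_∞' ∈ 𝔖_p`
  satisfying the relation `𝐳_∞ = (γ - 1) 𝐳_∞'` for `γ ∈ Γ` any topological generator. When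
  `E(K)[p] = 0` (so the `Λ`-module `𝔖_p` is torsion-free), `𝐳_∞'` is uniquely determined by (2.3)."

## Transcription (tree vocabulary only; nothing re-declared)

* Heegner points of conductor `p^{n+1}` at level `N` with `p ∣ N` ARE the tree's
  `IsHeegnerGeomPoint N W K Dt β (p^{n+1}) jbar` (`HeegnerModuleIndex.lean`): CM points `τ_Q` of
  primitive Heegner forms `Q = (A, B, C)` of level `N` (`N ∣ A`) and discriminant `d_K p^{2(n+1)}`
  with `B ≡ p^{n+1} β (mod 2N)`; for `p ∣ N` these are exactly Bertolini–Darmon's Heegner points of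
  conductor `p^{n+1}` on `X₀(N) = X_{N,1}` (§2.1–2.2: the isogeny `ℂ/⟨1, τ_Q⟩ → ℂ/⟨1, N τ_Q⟩` drops
  the conductor at `p` by one — e.g. `N = 11`, `d_K = -7`, `β = 9`, `Q = (121, 11, 2)` of
  discriminant `-847 = -7 · 11²`), rational over `K[p^{n+1}]` (§2.3). The tree's existence fact
  `exists_isHeegnerNormPoint` is printed for `gcd(c, N) = 1` only; NOTHING here needs or asserts
  existence at `p ∣ N` (a `HeegnerFamily` at such `p` is DATA the statements quantify over).
* A `HeegnerFamily N W K κ jbar` carries the norm points `F.z n = Norm_{K_n K[p^{n+1}]/K_n} P[p^{n+1}]`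
  (`IsHeegnerNormPoint … n (p^{n+1})`), genuine norms `Norm_{K[p^{n+1}]/K_n}` when `K_n ⊆ K[p^{n+1}]`,
  i.e. under the vocabulary's standing hypothesis `p ∤ h_K` (module docstring of
  `HeegnerModuleIndex.lean`, design notes). Under it, by (7) (`Norm_{K[p^{j+1}]/K[p^j]} y_{p^{j+1}} =
  α y_{p^j}`, `j ≥ 1`) the layer-`K_n` component of Castella's `𝐳_∞ ∈ 𝔖_p = lim←_n S_p(E/K_n)` is
  `cor_{H_{p^m}/K_n}(δ z_m) = α^{-m} δ(Norm_{H_{p^m}/K_n} y_{p^m}) = α^{-(n+1)} δ(F.z n)` for every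
  `m ≥ n + 1`, and `α^{-(n+1)} = α^{n+1}` as `α = ±1`. (Check at `n = 0` against (2.2)/(8):
  `cor_{H_1/K} z_0 = u⁻¹(1 - α⁻¹) y_K = α⁻¹ · Norm_{K[p]/K} y_p`.)
* Hence the DEFINITION: `z ∈ D.S` is the `Λ`-adic Heegner class of `F` with sign `α` iff for every
  layer `n` and every `k`, the `(n, k)` component `D.proj n z k ∈ H¹(Gal(K̄/K_n), E[p^k])` is
  `α^{n+1} •` the Kummer class `δ(Q) = [σ ↦ σ Q - Q]` of ANY `p^k`-th root `Q` of `F.z n`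
  (`kummerClassOver`; the class is root-independent, and roots exist in characteristic `0`,
  `zsmul_geomPoints_surjective_of_charZero` — exactly the device of the tree's `heegnerModuleLayer`).
  `T = γ - 1` acts on `D.S` (`LambdaAdicSelmerData.proj_X`), so Castella's (2.3) is the equation
  `z = (PowerSeries.X : Λ) • z'` in `D.S`; no separate definition is introduced for it.
* Regularizing sign: `α = a_p(E) ∈ {1, -1}` according as the multiplicative reduction at `p` is split
  or non-split (Castella §2.2: "Let `α` be the `p`-th Fourier coefficient of `f` (so `α = 1` or `-1`
  according to whether `E` has split or nonsplit multiplicative reduction at `p`)"); the predicate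
  takes `α : ℤ` as a parameter and the statements (`KellerYin2024/MultiplicativeHeegnerPoint…`)
  instantiate it by reduction type (`WeierstrassCurve.HasSplitMultiplicativeReductionAtPrime`).
* Sign convention of the Kummer map: the tree's (`σ Q - Q`, Silverman VIII.§2). A source using
  `Q - σ Q` has the class `-z`; every statement below depends on `z` only through `Λ z`.

## Contents (namespace `Literature.NumberTheory.EllipticCurves.Castella2024`)

* `IsLambdaAdicHeegnerClass D F α z` — the definition.
* PROVED API: `IsLambdaAdicHeegnerClass.proj_eq` (the component formula at a chosen root),
  `IsLambdaAdicHeegnerClass.unique` (two such classes are equal: `LambdaAdicSelmerData.ext`),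
  `IsLambdaAdicHeegnerClass.span_eq_of` (hence generate the same `Λ`-line).

## References

* [BertoliniDarmon1996] M. Bertolini, H. Darmon, *Heegner points on Mumford–Tate curves*, Invent.
  Math. 126 (1996) 413–456: §2.2 (Lemma 2.2, Heegner points of conductor `c pⁿ`, `p ∣ N`), §2.3
  (rationality over `K_n`), §2.4 (norm relations), §2.5 eq. (7)–(8) (regularized points `z_n`,
  `α = a_p = ±1`), Prop. 2.7 (norm compatibility).
* [Castella2024] F. Castella, *Exceptional zeros for Heegner points and `p`-converse to the theorem of
  Gross–Zagier and Kolyvagin*, arXiv:2409.01360 (2024), UNREFEREED: §1 (`𝔖_p`, `𝐳_∞`, `𝐳_∞^*`),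
  §2.2 eq. (2.2) (`z_m`), (2.3) (`𝐳_∞ = (γ-1) 𝐳_∞'`).
* [Howard2004HeegnerKolyvagin] B. Howard, Compositio Math. 140 (2004), §3.3 (the Kummer maps
  `δ_k : E(K_k) ⊗ ℤ_p → H¹(K_k, T_p E)`, the vocabulary of `HeegnerModuleIndex.lean`).
* Cell documents: `run/shared/lean/pub/bsd-littype/staging/bsd-littype-05/{LOCATOR,FAITHFULNESS}-05.md`
  (§3 GAP row "Thm 5.2.1 multHg"), `…/HANDOFF.md` § bsd-littype-11 (GAP row "Castella 2409 Thm
  1.3/2.1/2.2/Prop 3.2/Conj 3.3").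
-/

set_option autoImplicit false

noncomputable section

open scoped Classical

open WeierstrassCurve

universe u

namespace Literature.NumberTheory.EllipticCurves.Castella2024

variable {K : Type u} [Field K] [NumberField K] {N : ℕ} [NeZero N] {W : WeierstrassCurve ℚ}
  {p : ℕ} [Fact p.Prime] {κ : ZpExtension K p} {γ : Field.absoluteGaloisGroup K}
  {jbar : AlgebraicClosure K →+* ℂ}

/-- **The `Λ`-adic Heegner class of `p`-power conductor with regularizing sign `α`** (Bertolini–Darmon
1996, §2.5 eq. (7)–(8) and Prop. 2.7; Castella 2024, §2.2 eq. (2.2): `z_m = α^{-m} y_{p^m}`,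
`𝐳_∞ = {z_m}_m`, "its natural image in `𝔖_p`"). For a `Λ`-adic Selmer datum `D`
(`𝔖_p = lim←_n S_p(E/K_n)`), a Heegner family `F` (norm points `F.z n = Norm_{K[p^{n+1}]/K_n} P[p^{n+1}]`
of conductor `p^{n+1}`, any level `N`, in particular `p ∣ N`) and `α : ℤ` (`= a_p = ±1` at a
multiplicative prime), `z ∈ D.S` is the class whose component in `H¹(Gal(K̄/K_n), E[p^k])` is
`α^{n+1} • δ_{K_n}(F.z n)`, the Kummer class `[σ ↦ σ • Q - Q]` of any `Q ∈ E(K̄)` with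
`p^k • Q = F.z n` — the layer-`K_n` corestriction of `α^{-m} δ(y_{p^m})`, `m ≥ n+1`, by the norm
relation (7) (module docstring; `α^{-(n+1)} = α^{n+1}` for `α = ±1`). A DEFINITION; existence of such
a `z` (norm-compatibility, BD96 Prop. 2.7) is NOT asserted, uniqueness is `IsLambdaAdicHeegnerClass.unique`.
[cite: BertoliniDarmon1996, §2.5 eq. (7)–(8), Prop. 2.7] [cite: Howard2004HeegnerKolyvagin, §3.3 (Kummer maps δ_k)] -/
def IsLambdaAdicHeegnerClass (D : (W.baseChange K).LambdaAdicSelmerData κ γ)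
    (F : HeegnerFamily N W K κ jbar) (α : ℤ) (z : D.S) : Prop :=
  ∀ (n k : ℕ) (Q : geomPoints (W.baseChange K)) (hQ : ((p : ℤ) ^ k) • Q = F.z n),
    D.proj n z k = (α ^ (n + 1)) •
      (W.baseChange K).kummerClassOver (κ.layerSubgroup n) ((p : ℤ) ^ k) Q
        (fun σ hσ ↦ by rw [hQ]; exact (F.isHeegnerNormPoint_z n).smul_eq_self hσ)

namespace IsLambdaAdicHeegnerClass

variable {D : (W.baseChange K).LambdaAdicSelmerData κ γ} {F : HeegnerFamily N W K κ jbar} {α : ℤ}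
  {z z' : D.S}

/-- The component formula at a chosen `p^k`-th root `Q` of the norm point `F.z n` (unfolding).
[cite: BertoliniDarmon1996, §2.5 eq. (7)–(8)] -/
theorem proj_eq (h : IsLambdaAdicHeegnerClass D F α z) (n k : ℕ) (Q : geomPoints (W.baseChange K))
    (hQ : ((p : ℤ) ^ k) • Q = F.z n) :
    D.proj n z k = (α ^ (n + 1)) •
      (W.baseChange K).kummerClassOver (κ.layerSubgroup n) ((p : ℤ) ^ k) Q
        (fun σ hσ ↦ by rw [hQ]; exact (F.isHeegnerNormPoint_z n).smul_eq_self hσ) :=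
  h n k Q hQ

/-- **Uniqueness of the `Λ`-adic Heegner class**: two elements of `𝔖_p` with the defining components
are equal (roots of the norm points exist in characteristic `0`,
`zsmul_geomPoints_surjective_of_charZero`; the projections are jointly injective,
`LambdaAdicSelmerData.ext`). Castella 2024, §2.2 ("we obtain THE compatible family … `𝐳_∞`").
[cite: BertoliniDarmon1996, §2.5 Prop. 2.7] -/
theorem unique (h : IsLambdaAdicHeegnerClass D F α z) (h' : IsLambdaAdicHeegnerClass D F α z') :
    z = z' := by
  rw [← sub_eq_zero]
  refine D.ext _ fun n ↦ ?_
  rw [map_sub, sub_eq_zero]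
  funext k
  have hpk : ((p : ℤ) ^ k) ≠ 0 := pow_ne_zero _ (by exact_mod_cast (Fact.out : p.Prime).ne_zero)
  obtain ⟨Q, hQ⟩ := (W.baseChange K).zsmul_geomPoints_surjective_of_charZero hpk (F.z n)
  rw [h n k Q hQ, h' n k Q hQ]

/-- Consequently two `Λ`-adic Heegner classes of the same family and sign generate the same
`Λ`-submodule `Λ 𝐳_∞ ⊆ 𝔖_p` (the line whose index carries the Heegner point main conjecture).
[cite: BertoliniDarmon1996, §2.5 Prop. 2.7] -/
theorem span_eq_of (h : IsLambdaAdicHeegnerClass D F α z) (h' : IsLambdaAdicHeegnerClass D F α z') :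
    Submodule.span (IwasawaAlgebra p) {z} = Submodule.span (IwasawaAlgebra p) {z'} := by
  rw [h.unique h']

end IsLambdaAdicHeegnerClass

end Literature.NumberTheory.EllipticCurves.Castella2024

end
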